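/- Fleet lead `ym-wcr-19456-p1`, route `WeakCouplingRates`, crux `ColdBoxTwoPointFloor` (stmt-QuantumFields-19456). -/
import Summits.QuantumFields.YangMills.Theorems.WeakCouplingRatesDefs
import Literature.MathematicalPhysics.QuantumFieldTheory.CubicalCochainsBox

/-!
# Crux `ColdBoxTwoPointFloor`: the temporal-gauge Dirichlet Maxwell Gaussian of the cold-wall box is
# non-degenerate — its precision matrix is positive definite (`posDef_dirQmat`)

For D1' of `Theorems/WeakCouplingRatesDefs.lean` (`boxDirichlet H = LatticeMaxwell.τ (· ∉ dirFreeEdges H) dirCorner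
(2H+3) = N(0, Q_D⁻¹)`: density `∝ exp(−½ Σ_{p touching Λ} s(p)²)` on the free edges of the cold box `Λ = boxEdges 4 (2H+1)`
off the temporal gauge forest, all other edges pinned to `0`) this file proves that the form has TRIVIAL KERNEL
(`eq_zero_of_formM_eq_zero`) and hence `Q_D` is positive definite (`posDef_dirQmat`), so `boxDirichlet H` is a genuine
centred Gaussian (Mathlib's `multivariateGaussian 0 S` is a Dirac mass for singular data).  Chatterjee's
`LatticeMaxwell.posDef_Qmat` does not apply (it pins the COMB tree; the cold wall pins the collar and the temporal forest).
Proof = «a flat connection on the cold-wall box with trivial boundary links in temporal gauge is trivial»: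
`flat_of_formM_eq_zero` (form `= 0` ⇒ the glued `1`-cochain `dirGlue H s` is flat on the enlarged box
`[dirCorner, dirTop H]`); the tree's Poincaré lemma `LatticeForm.exists_d₀_eq_of_flat_on_box` (Forsström–Lenells–Viklund
2022, Lemma 2.2) gives a primitive `φ`; `φ` is constant on the collar (axis moves through edges with an endpoint outside
the cold box carry `0`: `phi_axisMove`, `phi_update_eq`, `phi_eq_of_apply_three/_eq_neg_one/_eq_top`) and on the cold
box (boundary vertices through one frozen edge, interior vertices up their forest line: `phi_eq_of_mem_box`), hence
everywhere (`phi_eq`): every glued edge value is `0`, `s = 0`.  Everything proved; no definition, no named fact; standard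
axioms.  NOT a statement about the mass gap.
-/

set_option autoImplicit false

noncomputable section

open MeasureTheory Finset Function
open Literature.MathematicalPhysics.QuantumFieldTheory
open Literature.MathematicalPhysics.QuantumFieldTheory.LatticeMaxwell
open Literature.MathematicalPhysics.QuantumFieldTheory.AxialGauge
open Literature.Probability.LatticeModels (Site mem_halfOpenBox)

namespace Summit.QuantumFields.YangMills.Theorems.WeakCouplingRates

section PosDef

variable {H : ℕ}

/-- Off the cold box the glued field vanishes. -/
theorem dirGlue_eq_zero_of_not_mem (s : DirFree H → ℝ) {e : Literature.MathematicalPhysics.QuantumLattice.ZdEdge 4}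
    (he : e ∉ boxEdges 4 (2 * H + 1)) : dirGlue H s e = 0 := by
  by_cases hb : e ∈ boxEdgesAt dirCorner (2 * H + 3)
  · rw [dirGlue, glue_apply_pin _ _ hb (fun hf => he (mem_dirFreeEdges.1 hf).1)]; rfl
  · exact glue_apply_of_not_mem _ _ hb

/-- On the temporal forest the glued field vanishes. -/
theorem dirGlue_eq_zero_of_forest (s : DirFree H → ℝ) {x : Site 4}
    (hx : ∀ k : Fin 4, 1 ≤ x k ∧ x k + 1 ≤ 2 * H) : dirGlue H s (x, 0) = 0 := by
  by_cases hb : (x, (0 : Fin 4)) ∈ boxEdgesAt dirCorner (2 * H + 3)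
  · rw [dirGlue, glue_apply_pin _ _ hb (fun hf => (mem_dirFreeEdges.1 hf).2 ⟨rfl, hx⟩)]; rfl
  · exact glue_apply_of_not_mem _ _ hb

/-- An edge with an endpoint outside the cold box `{0,…,2H}⁴` is not an edge of the box. -/
theorem not_mem_boxEdges_of_fst {x : Site 4} {i : Fin 4} (hx : ∃ k, x k < 0 ∨ 2 * (H : ℤ) < x k) :
    (x, i) ∉ boxEdges 4 (2 * H + 1) := by
  intro h
  rw [mem_boxEdges_iff] at h
  obtain ⟨k, hk⟩ := hx
  have := h.1 k
  push_cast at this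
  omega

/-- An edge whose far endpoint leaves the cold box is not an edge of the box. -/
theorem not_mem_boxEdges_of_snd {x : Site 4} {i : Fin 4}
    (hx : ∃ k : Fin 4, (x + Pi.single i (1 : ℤ) : Site 4) k < 0 ∨ 2 * (H : ℤ) < (x + Pi.single i (1 : ℤ) : Site 4) k) :
    (x, i) ∉ boxEdges 4 (2 * H + 1) := by
  intro h
  rw [mem_boxEdges] at h
  obtain ⟨k, hk⟩ := hx
  have := (mem_halfOpenBox.1 h.2) k
  push_cast at this
  omega

/-- The big box as an order interval: `{−1,…,2H+1}⁴ = [dirCorner, dirTop H]`. -/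
theorem mem_bigIcc_iff {x : Site 4} : x ∈ Set.Icc dirCorner (dirTop H) ↔ ∀ k, -1 ≤ x k ∧ x k ≤ 2 * (H : ℤ) + 1 := by
  simp only [Set.mem_Icc, Pi.le_def, dirCorner, dirTop]
  exact ⟨fun h k => ⟨h.1 k, h.2 k⟩, fun h => ⟨fun k => (h k).1, fun k => (h k).2⟩⟩

/-- A vertex of the big box, in relative coordinates, is a vertex of `halfOpenBox 4 (2H+3)`. -/
theorem sub_dirCorner_mem_halfOpenBox {x : Site 4} (hx : x ∈ Set.Icc dirCorner (dirTop H)) :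
    x - dirCorner ∈ Literature.Probability.LatticeModels.halfOpenBox 4 (2 * H + 3) := by
  rw [mem_halfOpenBox]
  intro k
  have := (mem_bigIcc_iff.1 hx) k
  simp only [Pi.sub_apply, dirCorner]
  push_cast
  omega

/-- **Flatness**: if the Dirichlet form vanishes, every plaquette circulation of the glued field in the big box
vanishes, i.e. the 1-cochain `(x, i) ↦ dirGlue s (x, i)` is flat on `[dirCorner, dirTop H]`. -/
theorem flat_of_formM_eq_zero (s : DirFree H → ℝ)
    (h0 : formM (fun e => e ∉ dirFreeEdges H) dirCorner (2 * H + 3) 0 s = 0) :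
    ∀ (x : Site 4) (i j : Fin 4), x ∈ Set.Icc dirCorner (dirTop H) →
      x + LatticeForm.e i + LatticeForm.e j ∈ Set.Icc dirCorner (dirTop H) →
        LatticeForm.d₁ (fun y k => dirGlue H s (y, k)) x i j = 0 := by
  -- every term of the (nonnegative) sum vanishes
  have hterm : ∀ p ∈ plaquettesIn (Literature.Probability.LatticeModels.halfOpenBox 4 (2 * H + 3)),
      sCirc (dirGlue H s) (Plaq.shift dirCorner p) = 0 := by
    intro p hp
    have hsum := (Finset.sum_eq_zero_iff_of_nonneg (fun q _ => sq_nonneg _)).1 h0 p hp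
    exact pow_eq_zero_iff (n := 2) (by norm_num) |>.1 hsum
  -- the three cases i = j, i < j, j < i
  intro x i j hx hxij
  rcases lt_trichotomy i j with hij | rfl | hji
  · -- the plaquette (x - corner; i, j) of the relative box
    have hxi : ∀ k, -1 ≤ x k ∧ x k ≤ 2 * (H : ℤ) + 1 := mem_bigIcc_iff.1 hx
    have hxij' : ∀ k, -1 ≤ (x + LatticeForm.e i + LatticeForm.e j) k ∧
        (x + LatticeForm.e i + LatticeForm.e j) k ≤ 2 * (H : ℤ) + 1 := mem_bigIcc_iff.1 hxij
    have hmem : ((x - dirCorner, i, j) : Plaq 4) ∈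
        plaquettesIn (Literature.Probability.LatticeModels.halfOpenBox 4 (2 * H + 3)) := by
      rw [Plaq.mem_plaquettesIn]
      refine ⟨sub_dirCorner_mem_halfOpenBox hx, hij, ?_, ?_, ?_⟩ <;>
      · rw [mem_halfOpenBox]; intro k
        have h1 := hxi k; have h2 := hxij' k
        simp only [Pi.add_apply, Pi.sub_apply, dirCorner, LatticeForm.e, Pi.single_apply] at h1 h2 ⊢
        split_ifs at h2 ⊢ <;> push_cast <;> omega
    have h := hterm _ hmem
    have hshift : Plaq.shift dirCorner ((x - dirCorner, i, j) : Plaq 4) = (x, i, j) := by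
      simp [Plaq.shift]
    rw [hshift] at h
    simpa [LatticeForm.d₁, sCirc, LatticeForm.e] using h
  · exact LatticeForm.d₁_self _ _ _
  · have hxji : x + LatticeForm.e j + LatticeForm.e i ∈ Set.Icc dirCorner (dirTop H) := by
      rwa [add_right_comm]
    have hxi : ∀ k, -1 ≤ x k ∧ x k ≤ 2 * (H : ℤ) + 1 := mem_bigIcc_iff.1 hx
    have hxij' : ∀ k, -1 ≤ (x + LatticeForm.e j + LatticeForm.e i) k ∧
        (x + LatticeForm.e j + LatticeForm.e i) k ≤ 2 * (H : ℤ) + 1 := mem_bigIcc_iff.1 hxji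
    have hmem : ((x - dirCorner, j, i) : Plaq 4) ∈
        plaquettesIn (Literature.Probability.LatticeModels.halfOpenBox 4 (2 * H + 3)) := by
      rw [Plaq.mem_plaquettesIn]
      refine ⟨sub_dirCorner_mem_halfOpenBox hx, hji, ?_, ?_, ?_⟩ <;>
      · rw [mem_halfOpenBox]; intro k
        have h1 := hxi k; have h2 := hxij' k
        simp only [Pi.add_apply, Pi.sub_apply, dirCorner, LatticeForm.e, Pi.single_apply] at h1 h2 ⊢
        split_ifs at h2 ⊢ <;> push_cast <;> omega
    have h := hterm _ hmem
    have hshift : Plaq.shift dirCorner ((x - dirCorner, j, i) : Plaq 4) = (x, j, i) := by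
      simp [Plaq.shift]
    rw [hshift] at h
    rw [LatticeForm.d₁_swap, neg_eq_zero]
    simpa [LatticeForm.d₁, sCirc, LatticeForm.e] using h

/-! ### Constancy of the primitive: the cold wall and the temporal forest pin everything -/

/-- A glued edge value vanishes as soon as one endpoint lies outside the cold box `{0,…,2H}⁴`. -/
theorem dirGlue_eq_zero_of_endpoint (s : DirFree H → ℝ) {x : Site 4} {i : Fin 4}
    (h : (∃ k, x k < 0 ∨ 2 * (H : ℤ) < x k) ∨
      (∃ k : Fin 4, (x + Pi.single i (1 : ℤ) : Site 4) k < 0 ∨ 2 * (H : ℤ) < (x + Pi.single i (1 : ℤ) : Site 4) k)) :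
    dirGlue H s (x, i) = 0 := by
  rcases h with h | h
  · exact dirGlue_eq_zero_of_not_mem s (not_mem_boxEdges_of_fst h)
  · exact dirGlue_eq_zero_of_not_mem s (not_mem_boxEdges_of_snd h)

variable (s : DirFree H → ℝ) (φ : Site 4 → ℝ)
  (hφ : ∀ (x : Site 4) (i : Fin 4), x ∈ Set.Icc dirCorner (dirTop H) →
    x + LatticeForm.e i ∈ Set.Icc dirCorner (dirTop H) →
      LatticeForm.d₀ φ x i = dirGlue H s (x, i))

include hφ in
/-- **Moving along an axis through zero edges does not change the primitive.**  Along the axis `j`, starting from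
the coordinate value `−1`, if the first `m` edges of the line carry the value `0`, then `φ` agrees at its two ends. -/
theorem phi_axisMove (y : Site 4) (j : Fin 4) (hy : ∀ k, k ≠ j → -1 ≤ y k ∧ y k ≤ 2 * (H : ℤ) + 1) :
    ∀ m : ℕ, (m : ℤ) ≤ 2 * H + 2 →
      (∀ t : ℕ, t < m → dirGlue H s (update y j (-1 + t), j) = 0) →
        φ (update y j (-1 + m)) = φ (update y j (-1)) := by
  intro m
  induction m with
  | zero => intro _ _; simp
  | succ m ih =>
    intro hm hz
    have hm' : (m : ℤ) ≤ 2 * H + 2 := by push_cast at hm; omega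
    have h1 := ih hm' fun t ht => hz t (Nat.lt_succ_of_lt ht)
    have hmem : update y j (-1 + (m : ℤ)) ∈ Set.Icc dirCorner (dirTop H) := by
      rw [LatticeForm.update_mem_Icc_iff]
      refine ⟨⟨by simp [dirCorner], by simp only [dirTop]; omega⟩, fun k hk => ?_⟩
      simp only [dirCorner, dirTop]; exact hy k hk
    have hmem' : update y j (-1 + (m : ℤ)) + LatticeForm.e j ∈ Set.Icc dirCorner (dirTop H) := by
      rw [LatticeForm.e, LatticeForm.update_add_single_eq, LatticeForm.update_mem_Icc_iff]
      refine ⟨⟨by simp only [dirCorner]; omega, by simp only [dirTop]; push_cast at hm; omega⟩, fun k hk => ?_⟩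
      simp only [dirCorner, dirTop]; exact hy k hk
    have hd := hφ _ j hmem hmem'
    rw [hz m (Nat.lt_succ_self m), LatticeForm.d₀, LatticeForm.e, LatticeForm.update_add_single_eq, sub_eq_zero] at hd
    have e1 : (-1 : ℤ) + ((m + 1 : ℕ) : ℤ) = -1 + (m : ℤ) + 1 := by push_cast; ring
    rw [e1, hd, h1]

include hφ in
/-- Moving along the axis `j` from the value `−1` to `v`, at a point whose coordinate `k ≠ j` is frozen OUTSIDE the
cold box (`= −1` or `= 2H+1`): every edge of the move has an endpoint outside the box, so `φ` does not change. -/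
theorem phi_update_eq (w : Site 4) (j k : Fin 4) (hkj : k ≠ j) (hw : w ∈ Set.Icc dirCorner (dirTop H))
    (hk : w k = -1 ∨ w k = 2 * (H : ℤ) + 1) (hwj : w j = -1) {v : ℤ} (hv1 : -1 ≤ v) (hv2 : v ≤ 2 * (H : ℤ) + 1) :
    φ (update w j v) = φ w := by
  have hwb := mem_bigIcc_iff.1 hw
  have hy : ∀ k', k' ≠ j → -1 ≤ w k' ∧ w k' ≤ 2 * (H : ℤ) + 1 := fun k' _ => hwb k'
  have hm : (((v + 1).toNat : ℕ) : ℤ) ≤ 2 * H + 2 := by omega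
  have h := phi_axisMove s φ hφ w j hy (v + 1).toNat hm (fun t _ => by
    refine dirGlue_eq_zero_of_endpoint s (Or.inl ⟨k, ?_⟩)
    rw [update_of_ne hkj]
    rcases hk with hk | hk <;> [left; right] <;> omega)
  have e1 : (-1 : ℤ) + ((v + 1).toNat : ℕ) = v := by omega
  rw [e1] at h
  rw [h, ← hwj, update_eq_self]

include hφ in
/-- Vertices of the big box with last coordinate `−1` (the bottom collar in direction `3`): `φ = φ(corner)`. -/
theorem phi_eq_of_apply_three (y : Site 4) (hy : y ∈ Set.Icc dirCorner (dirTop H)) (h3 : y 3 = -1) :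
    φ y = φ dirCorner := by
  have hyb := mem_bigIcc_iff.1 hy
  -- the axis path corner → y through coordinates 0, 1, 2 (coordinate 3 stays at −1)
  set y1 : Site 4 := update dirCorner 0 (y 0) with hy1
  set y2 : Site 4 := update y1 1 (y 1) with hy2
  set y3 : Site 4 := update y2 2 (y 2) with hy3
  have hc : (dirCorner : Site 4) ∈ Set.Icc dirCorner (dirTop H) :=
    mem_bigIcc_iff.2 fun k => ⟨le_rfl, by simp only [dirCorner]; omega⟩
  have hy1m : y1 ∈ Set.Icc dirCorner (dirTop H) := by
    rw [hy1, LatticeForm.update_mem_Icc_iff]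
    exact ⟨⟨(hyb 0).1, (hyb 0).2⟩, fun m _ => ⟨le_rfl, by simp only [dirCorner, dirTop]; omega⟩⟩
  have hy2m : y2 ∈ Set.Icc dirCorner (dirTop H) := by
    rw [hy2, LatticeForm.update_mem_Icc_iff]
    exact ⟨⟨(hyb 1).1, (hyb 1).2⟩, (LatticeForm.mem_Icc_iff_inBoxAway 1).1 hy1m |>.2⟩
  have e1 : φ y1 = φ dirCorner :=
    phi_update_eq s φ hφ dirCorner 0 3 (by decide) hc (Or.inl rfl) rfl (hyb 0).1 (hyb 0).2
  have e2 : φ y2 = φ y1 :=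
    phi_update_eq s φ hφ y1 1 3 (by decide) hy1m (Or.inl (by simp [hy1, dirCorner])) (by simp [hy1, dirCorner])
      (hyb 1).1 (hyb 1).2
  have e3 : φ y3 = φ y2 :=
    phi_update_eq s φ hφ y2 2 3 (by decide) hy2m (Or.inl (by simp [hy2, hy1, dirCorner]))
      (by simp [hy2, hy1, dirCorner]) (hyb 2).1 (hyb 2).2
  have e4 : y3 = y := by
    funext k
    fin_cases k <;> simp [hy3, hy2, hy1, dirCorner, h3]
  rw [← e4, e3, e2, e1]

include hφ in
/-- Vertices of the big box with SOME coordinate `−1`: `φ = φ(corner)`. -/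
theorem phi_eq_of_apply_eq_neg_one (y : Site 4) (hy : y ∈ Set.Icc dirCorner (dirTop H)) {k : Fin 4}
    (hk : y k = -1) : φ y = φ dirCorner := by
  by_cases hk3 : k = 3
  · subst hk3; exact phi_eq_of_apply_three s φ hφ y hy hk
  · have hyb := mem_bigIcc_iff.1 hy
    set w : Site 4 := update y 3 (-1) with hw
    have hwm : w ∈ Set.Icc dirCorner (dirTop H) := by
      rw [hw, LatticeForm.update_mem_Icc_iff]
      exact ⟨⟨le_rfl, by simp only [dirTop]; omega⟩, (LatticeForm.mem_Icc_iff_inBoxAway 3).1 hy |>.2⟩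
    have e1 : φ w = φ dirCorner := phi_eq_of_apply_three s φ hφ w hwm (by simp [hw])
    have e2 : φ (update w 3 (y 3)) = φ w :=
      phi_update_eq s φ hφ w 3 k hk3 hwm (Or.inl (by rw [hw, update_of_ne hk3]; exact hk)) (by simp [hw])
        (hyb 3).1 (hyb 3).2
    have e3 : update w 3 (y 3) = y := by rw [hw, update_idem, update_eq_self]
    rw [← e3, e2, e1]

include hφ in
/-- Vertices of the big box with SOME coordinate `2H+1` (the top collar): `φ = φ(corner)`. -/
theorem phi_eq_of_apply_eq_top (y : Site 4) (hy : y ∈ Set.Icc dirCorner (dirTop H)) {k : Fin 4}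
    (hk : y k = 2 * (H : ℤ) + 1) : φ y = φ dirCorner := by
  have hyb := mem_bigIcc_iff.1 hy
  -- an auxiliary axis j ≠ k
  obtain ⟨j, hjk⟩ : ∃ j : Fin 4, k ≠ j := by
    by_cases hk0 : k = 0
    · exact ⟨1, by rw [hk0]; decide⟩
    · exact ⟨0, hk0⟩
  set w : Site 4 := update y j (-1) with hw
  have hwm : w ∈ Set.Icc dirCorner (dirTop H) := by
    rw [hw, LatticeForm.update_mem_Icc_iff]
    exact ⟨⟨le_rfl, by simp only [dirTop]; omega⟩, (LatticeForm.mem_Icc_iff_inBoxAway j).1 hy |>.2⟩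
  have e1 : φ w = φ dirCorner := phi_eq_of_apply_eq_neg_one s φ hφ w hwm (k := j) (by simp [hw])
  have e2 : φ (update w j (y j)) = φ w :=
    phi_update_eq s φ hφ w j k hjk hwm (Or.inr (by rw [hw, update_of_ne hjk]; exact hk)) (by simp [hw])
      (hyb j).1 (hyb j).2
  have e3 : update w j (y j) = y := by rw [hw, update_idem, update_eq_self]
  rw [← e3, e2, e1]

include hφ in
/-- Vertices of the cold box `{0,…,2H}⁴`: `φ = φ(corner)` — boundary vertices through a frozen outside edge, interior
vertices up their temporal forest line (induction on the distance to the top face). -/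
theorem phi_eq_of_mem_box : ∀ (m : ℕ) (y : Site 4), (∀ k, 0 ≤ y k ∧ y k ≤ 2 * (H : ℤ)) →
    (2 * (H : ℤ) - y 0).toNat ≤ m → φ y = φ dirCorner := by
  have hIcc : ∀ y : Site 4, (∀ k, 0 ≤ y k ∧ y k ≤ 2 * (H : ℤ)) → y ∈ Set.Icc dirCorner (dirTop H) := fun y hy =>
    mem_bigIcc_iff.2 fun k => ⟨by linarith [(hy k).1], by linarith [(hy k).2]⟩
  -- boundary vertices
  have hbd : ∀ y : Site 4, (∀ k, 0 ≤ y k ∧ y k ≤ 2 * (H : ℤ)) → ∀ k, (y k = 0 ∨ y k = 2 * (H : ℤ)) →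
      φ y = φ dirCorner := by
    intro y hy k hk
    have hyI := hIcc y hy
    rcases hk with hk | hk
    · -- through the frozen edge (y - e_k, k)
      set z : Site 4 := update y k (-1) with hz
      have hzm : z ∈ Set.Icc dirCorner (dirTop H) := by
        rw [hz, LatticeForm.update_mem_Icc_iff]
        exact ⟨⟨le_rfl, by simp only [dirTop]; omega⟩, (LatticeForm.mem_Icc_iff_inBoxAway k).1 hyI |>.2⟩
      have hze : z + LatticeForm.e k = y := by
        rw [hz, LatticeForm.e, LatticeForm.update_add_single_eq]; simp [← hk]
      have hd := hφ z k hzm (by rw [hze]; exact hyI)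
      rw [dirGlue_eq_zero_of_endpoint s (Or.inl ⟨k, Or.inl (by simp [hz])⟩), LatticeForm.d₀, hze, sub_eq_zero] at hd
      rw [hd]
      exact phi_eq_of_apply_eq_neg_one s φ hφ z hzm (k := k) (by simp [hz])
    · -- through the frozen edge (y, k)
      have hym : y + LatticeForm.e k ∈ Set.Icc dirCorner (dirTop H) := by
        refine mem_bigIcc_iff.2 fun k' => ?_
        by_cases hk' : k' = k
        · subst hk'; simp [LatticeForm.e, hk]; omega
        · simp only [LatticeForm.e, Pi.add_apply, Pi.single_eq_of_ne hk', add_zero]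
          exact ⟨by linarith [(hy k').1], by linarith [(hy k').2]⟩
      have hd := hφ y k hyI hym
      have htop : (y + LatticeForm.e k) k = 2 * (H : ℤ) + 1 := by simp [LatticeForm.e, hk]
      rw [dirGlue_eq_zero_of_endpoint s (Or.inr ⟨k, Or.inr (by rw [← LatticeForm.e, htop]; omega)⟩),
        LatticeForm.d₀, sub_eq_zero] at hd
      rw [← hd]
      exact phi_eq_of_apply_eq_top s φ hφ _ hym htop
  intro m
  induction m with
  | zero =>
    intro y hy h0
    have : y 0 = 2 * (H : ℤ) := by have := (hy 0).2; omega
    exact hbd y hy 0 (Or.inr this)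
  | succ m ih =>
    intro y hy hm
    by_cases hb : ∃ k, y k = 0 ∨ y k = 2 * (H : ℤ)
    · obtain ⟨k, hk⟩ := hb; exact hbd y hy k hk
    · -- interior vertex: up the temporal forest edge
      push Not at hb
      have hint : ∀ k : Fin 4, 1 ≤ y k ∧ y k + 1 ≤ 2 * (H : ℤ) := fun k => by
        have := hy k; have := hb k; omega
      have hint' : ∀ k : Fin 4, 1 ≤ y k ∧ y k + 1 ≤ 2 * H := fun k => by
        have := hint k; exact ⟨this.1, by exact_mod_cast this.2⟩
      have hyI := hIcc y hy
      have hy' : ∀ k, 0 ≤ (y + LatticeForm.e 0 : Site 4) k ∧ (y + LatticeForm.e 0 : Site 4) k ≤ 2 * (H : ℤ) :=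
        fun k => by
        by_cases hk : k = 0
        · subst hk
          simp only [LatticeForm.e, Pi.add_apply, Pi.single_eq_same]
          constructor <;> linarith [(hy 0).1, (hint 0).2]
        · simp only [LatticeForm.e, Pi.add_apply, Pi.single_eq_of_ne hk, add_zero]; exact hy k
      have hd := hφ y 0 hyI (hIcc _ hy')
      rw [dirGlue_eq_zero_of_forest s hint', LatticeForm.d₀, sub_eq_zero] at hd
      rw [← hd]
      refine ih _ hy' ?_
      simp [LatticeForm.e]
      omega

include hφ in
/-- **The primitive is constant on the whole big box.** -/
theorem phi_eq (y : Site 4) (hy : y ∈ Set.Icc dirCorner (dirTop H)) : φ y = φ dirCorner := by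
  have hyb := mem_bigIcc_iff.1 hy
  by_cases hV : ∀ k, 0 ≤ y k ∧ y k ≤ 2 * (H : ℤ)
  · exact phi_eq_of_mem_box s φ hφ _ y hV le_rfl
  · push Not at hV
    obtain ⟨k, hk⟩ := hV
    by_cases h0 : 0 ≤ y k
    · have : y k = 2 * (H : ℤ) + 1 := by have := hk h0; have := (hyb k).2; omega
      exact phi_eq_of_apply_eq_top s φ hφ y hy this
    · have : y k = -1 := by have := (hyb k).1; omega
      exact phi_eq_of_apply_eq_neg_one s φ hφ y hy this

/-- **The Dirichlet form has trivial kernel**: if `Σ_{p} s(p)² = 0` over the plaquettes of the big box (pinned values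
`0`), then `s = 0` — the cold wall and the temporal forest leave no flat direction. -/
theorem eq_zero_of_formM_eq_zero (s : DirFree H → ℝ)
    (h0 : formM (fun e => e ∉ dirFreeEdges H) dirCorner (2 * H + 3) 0 s = 0) : s = 0 := by
  obtain ⟨φ, hφ⟩ := LatticeForm.exists_d₀_eq_of_flat_on_box (fun y k => dirGlue H s (y, k)) dirCorner (dirTop H)
    (flat_of_formM_eq_zero s h0)
  funext e
  obtain ⟨⟨⟨x, i⟩, he⟩, hp⟩ := e
  have hmem := (mem_boxEdgesAt.1 he)
  rw [mem_boxEdges_iff] at hmem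
  have hx : x ∈ Set.Icc dirCorner (dirTop H) := mem_bigIcc_iff.2 fun k => by
    have := hmem.1 k; simp only [Pi.sub_apply, dirCorner] at this; push_cast at this; omega
  have hxi : x + LatticeForm.e i ∈ Set.Icc dirCorner (dirTop H) := mem_bigIcc_iff.2 fun k => by
    have h1 := hmem.1 k; have h2 := hmem.2
    simp only [Pi.sub_apply, dirCorner] at h1 h2; push_cast at h1 h2
    by_cases hk : k = i
    · subst hk; simp [LatticeForm.e]; omega
    · simp only [LatticeForm.e, Pi.add_apply, Pi.single_eq_of_ne hk, add_zero]; omega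
  have hd := hφ x i hx hxi
  rw [LatticeForm.d₀, phi_eq s φ hφ _ hxi, phi_eq s φ hφ _ hx, sub_self] at hd
  have hs : s ⟨⟨(x, i), he⟩, hp⟩ = dirGlue H s (x, i) :=
    (glue_apply_free (pin := fun e => e ∉ dirFreeEdges H) 0 s ⟨⟨(x, i), he⟩, hp⟩).symm
  rw [hs, ← hd]; rfl

/-- **The precision matrix of the Dirichlet Maxwell Gaussian of the cold-wall box is positive definite** (so
`boxDirichlet H = N(0, Q⁻¹)` is a genuine, non-degenerate centred Gaussian on `ℝ^{DirFree H}`). -/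
theorem posDef_dirQmat (H : ℕ) : (Qmat (fun e => e ∉ dirFreeEdges H) dirCorner (2 * H + 3)).PosDef := by
  refine Matrix.PosDef.of_dotProduct_mulVec_pos ?_ fun v hv => ?_
  · rw [Matrix.IsHermitian, Matrix.conjTranspose_eq_transpose_of_trivial, Qmat_transpose]
  · simp only [star_trivial]
    rw [dotProduct_Qmat_mulVec]
    have hnn : 0 ≤ formM (fun e => e ∉ dirFreeEdges H) dirCorner (2 * H + 3) 0 v :=
      Finset.sum_nonneg fun p _ => sq_nonneg _
    rcases hnn.lt_or_eq with h | h
    · exact h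
    · exact absurd (eq_zero_of_formM_eq_zero v h.symm) hv

end PosDef

end Summit.QuantumFields.YangMills.Theorems.WeakCouplingRates

end
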